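import Literature.MathematicalPhysics.QuantumLattice.FermionOperatorsProofs
import HarnessLib

/-!
# Yang's commutator for a RESTRICTED `η`-pair creator sum: bulk term `(U − 2μ)` plus a boundary pair-creation term

Topic `Literature/MathematicalPhysics/QuantumLattice` (family `hubbard`; cell `hubbard-obs`, seat `hubbard-obs-p1`).
Pure CAR algebra on the fermionic Fock space of a finite vertex set `V` (Jordan–Wigner matrices of
`FermionOperators.lean`), companion of `FermionOperatorsProofs.lean` (`hamiltonian_commutator_etaRaise`:
Yang's `[H(t,U), η†_ε] = U η†_ε` for the FULL `η†` of a bipartite sign). Here the pair-creator sum is RESTRICTED to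
the image of an injection `ι : W ↪ V` ("inner" sites), `P = Σ_w ε_{ι w} c†_{ι w↑} c†_{ι w↓}`, with `ε` bipartite on the
inner bonds only. Then (all PROVED, no definition, no named fact, no `sorry`):

* `hopping_commutator_pairCreation` — the hopping operator `T = Σ_{x∼y,σ} c†_{xσ}c_{yσ}` of any finite graph against
  ONE pair creator: `[T, c†_{z↑}c†_{z↓}] = Σ_{x∼z} K(x,z)`, `K(x,z) = c†_{x↑}c†_{z↓} − c†_{x↓}c†_{z↑}` (symmetric,
  `pairCreationBond_symm`);
* `hopping_commutator_restrictedEtaRaise` — **Yang's cancellation, restricted**: `[T, P] = D_∂`, the inner bonds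
  cancel in pairs and only the BOUNDARY sum `D_∂ = Σ_{x ∉ ι(W)} Σ_{w : x ∼ ι w} ε_{ι w} K(x, ι w)` survives;
* `interaction_commutator_restrictedEtaRaise` (`[Σ n↑n↓, P] = P`), `totalNumber_commutator_restrictedEtaRaise`
  (`[N, P] = 2P`), whence `hamiltonian_commutator_restrictedEtaRaise` (`[H(t,U), P] = U P − t D_∂`) and
  `hamiltonianMu_commutator_restrictedEtaRaise`: **`[H(1,U) − μN, P] = (U − 2μ) P − D_∂`**.

This is the algebra behind the exclusion of `η`-pairing (staggered on-site, `Q = (π,π)`) long-range order in ground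
states with `2μ < U` (`HubbardEtaPairingNoLROBelowHalfCoupling.lean`): removing the `η`-pairs of a region gains
`U − 2μ` per pair in the bulk, at a cost supported on the boundary bonds only.

## Sources
C. N. Yang, *η pairing and off-diagonal long-range order in a Hubbard model*, Phys. Rev. Lett. **63** (1989) 2144,
eqs. (4)–(6) [cite: Yang1989, eq. (6)]; F. H. L. Essler, H. Frahm, F. Göhmann, A. Klümper, V. E. Korepin,
*The One-Dimensional Hubbard Model* (CUP 2005), §2.2 eq. (2.72), §2.2.5 eqs. (2.84), (2.87)
[cite: EsslerEtAl2005, §2.2.5 eq. (2.84)]. The restriction-with-boundary form is elementary bookkeeping on top of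
these (in-house; no claim of novelty).
-/

noncomputable section

namespace Literature.MathematicalPhysics.QuantumLattice

open Matrix Finset HubbardWave0
open scoped ComplexOrder

/-! ### §1 Operator algebra on a finite vertex set: Yang's commutator for a RESTRICTED pair-creator sum -/

section Algebra

variable {V : Type*} [LinearOrder V] [Fintype V] {W : Type*} [Fintype W]

/-- The hopping term of `hamiltonian G t U` commuted with ONE pair creator, summed over spin:
`Σ_σ [c†_{xσ} c_{yσ}, c†_{z↑} c†_{z↓}] = δ_{yz} (c†_{x↑} c†_{z↓} − c†_{x↓} c†_{z↑})`.
[cite: Yang1989, eq. (6)] [cite: EsslerEtAl2005, §2.2 eq. (2.72)] -/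
theorem sum_hopTerm_commutator_pairCreation (x y z : V) :
    ∑ σ : Fin 2, (creation (orb x σ) * annihilation (orb y σ) * (creation (orb z 0) * creation (orb z 1)) -
        creation (orb z 0) * creation (orb z 1) * (creation (orb x σ) * annihilation (orb y σ))) =
      if y = z then creation (orb x 0) * creation (orb z 1) - creation (orb x 1) * creation (orb z 0) else 0 := by
  simp only [hop_pair_commutator, Fin.sum_univ_two, orb_eq_orb_iff]
  by_cases h : y = z
  · subst h
    simp [sub_eq_add_neg]
  · simp [h]

omit [Fintype W] in
/-- Commutator with a finite linear combination, term by term: `[A, Σ_w c_w p_w] = Σ_w c_w [A, p_w]`. [folklore] -/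
private theorem mul_sum_smul_sub_sum_smul_mul {M : Type*} [Ring M] [Module ℂ M] [IsScalarTower ℂ M M]
    [SMulCommClass ℂ M M] (A : M) (s : Finset W) (c : W → ℂ) (p : W → M) :
    A * (∑ w ∈ s, c w • p w) - (∑ w ∈ s, c w • p w) * A = ∑ w ∈ s, c w • (A * p w - p w * A) := by
  simp only [mul_sum, sum_mul, mul_smul_comm, smul_mul_assoc, smul_sub, sum_sub_distrib]

/-- The pair-creator combination `K(x,z) = c†_{x↑} c†_{z↓} − c†_{x↓} c†_{z↑}` is symmetric in `x, z`
(the singlet bond pair creator). [cite: Yang1989, eq. (6)] -/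
theorem pairCreationBond_symm (x z : V) :
    creation (orb z 0) * creation (orb x 1) - creation (orb z 1) * creation (orb x 0) =
      creation (orb x 0) * creation (orb z 1) - creation (orb x 1) * creation (orb z 0) := by
  rw [creation_mul_creation_eq_neg (orb z 0) (orb x 1), creation_mul_creation_eq_neg (orb z 1) (orb x 0)]
  abel

/-- **The hopping term against ONE pair creator**: for the hopping operator
`T = Σ_{x∼y,σ} c†_{xσ} c_{yσ}` of a finite graph and a site `z`,
`T c†_{z↑}c†_{z↓} − c†_{z↑}c†_{z↓} T = Σ_{x ∼ z} K(x,z)`. [cite: Yang1989, eq. (6)] -/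
theorem hopping_commutator_pairCreation (G : SimpleGraph V) [DecidableRel G.Adj] (z : V) :
    (∑ x, ∑ y, ∑ σ : Fin 2, if G.Adj x y then creation (orb x σ) * annihilation (orb y σ) else 0) *
        (creation (orb z 0) * creation (orb z 1)) -
      creation (orb z 0) * creation (orb z 1) *
        (∑ x, ∑ y, ∑ σ : Fin 2, if G.Adj x y then creation (orb x σ) * annihilation (orb y σ) else 0) =
      ∑ x, if G.Adj x z then
        creation (orb x 0) * creation (orb z 1) - creation (orb x 1) * creation (orb z 0) else 0 := by
  have hterm : ∀ x y (σ : Fin 2),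
      (if G.Adj x y then creation (orb x σ) * annihilation (orb y σ) else 0) * (creation (orb z 0) * creation (orb z 1)) -
        creation (orb z 0) * creation (orb z 1) * (if G.Adj x y then creation (orb x σ) * annihilation (orb y σ) else 0) =
      if G.Adj x y then (creation (orb x σ) * annihilation (orb y σ) * (creation (orb z 0) * creation (orb z 1)) -
        creation (orb z 0) * creation (orb z 1) * (creation (orb x σ) * annihilation (orb y σ))) else 0 := by
    intro x y σ
    split_ifs <;> simp
  simp only [sum_mul, mul_sum, ← sum_sub_distrib, hterm]
  refine sum_congr rfl fun x _ => ?_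
  have hy : ∀ y, (∑ σ : Fin 2, if G.Adj x y then
      (creation (orb x σ) * annihilation (orb y σ) * (creation (orb z 0) * creation (orb z 1)) -
        creation (orb z 0) * creation (orb z 1) * (creation (orb x σ) * annihilation (orb y σ))) else 0) =
      if y = z then (if G.Adj x y then
        creation (orb x 0) * creation (orb y 1) - creation (orb x 1) * creation (orb y 0) else 0) else 0 := by
    intro y
    by_cases hxy : G.Adj x y
    · simp only [if_pos hxy, sum_hopTerm_commutator_pairCreation]
      by_cases hyz : y = z
      · subst hyz; simp
      · simp [hyz]
    · simp [hxy]
  simp only [hy, sum_ite_eq', mem_univ, if_true]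

/-- **Yang's cancellation, restricted**: for an injection `ι : W ↪ V` of "inner" sites and a sign `ε` that
is bipartite on the inner bonds (`ε (ι w) = −ε (ι w')` whenever `ι w ∼ ι w'`), the hopping term commuted
with the RESTRICTED pair-creator sum `P = Σ_w ε_{ι w} c†_{ι w,↑} c†_{ι w,↓}` leaves only BOUNDARY terms:
`T P − P T = Σ_{x ∉ ι(W)} Σ_{w : x ∼ ι w} ε_{ι w} K(x, ι w)` (inner bonds cancel in pairs, exactly as in
`hopping_commute_etaRaise`). [cite: Yang1989, eq. (6)] [cite: EsslerEtAl2005, §2.2.5 eq. (2.84)] -/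
theorem hopping_commutator_restrictedEtaRaise (G : SimpleGraph V) [DecidableRel G.Adj] (ι : W ↪ V)
    (ε : V → ℤˣ) (hε : ∀ w w' : W, G.Adj (ι w) (ι w') → ε (ι w) = -ε (ι w')) :
    (∑ x, ∑ y, ∑ σ : Fin 2, if G.Adj x y then creation (orb x σ) * annihilation (orb y σ) else 0) *
        (∑ w, ((ε (ι w) : ℤ) : ℂ) • (creation (orb (ι w) 0) * creation (orb (ι w) 1))) -
      (∑ w, ((ε (ι w) : ℤ) : ℂ) • (creation (orb (ι w) 0) * creation (orb (ι w) 1))) *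
        (∑ x, ∑ y, ∑ σ : Fin 2, if G.Adj x y then creation (orb x σ) * annihilation (orb y σ) else 0) =
      ∑ x ∈ (univ.map ι)ᶜ, ∑ w, if G.Adj x (ι w) then
        ((ε (ι w) : ℤ) : ℂ) • (creation (orb x 0) * creation (orb (ι w) 1) - creation (orb x 1) * creation (orb (ι w) 0))
        else 0 := by
  set K : V → V → Matrix (Finset (Orb V)) (Finset (Orb V)) ℂ := fun x z =>
    creation (orb x 0) * creation (orb z 1) - creation (orb x 1) * creation (orb z 0) with hK
  rw [mul_sum_smul_sub_sum_smul_mul]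
  simp only [hopping_commutator_pairCreation, smul_sum, smul_ite, smul_zero]
  rw [sum_comm, ← sum_add_sum_compl (univ.map ι), sum_map, add_eq_right]
  -- the inner double sum vanishes by antisymmetry under `w ↔ w'`
  set S := ∑ w' : W, ∑ w : W, (if G.Adj (ι w') (ι w) then ((ε (ι w) : ℤ) : ℂ) • K (ι w') (ι w) else 0) with hS
  have hneg : S = -S := by
    conv_rhs => rw [hS, sum_comm]
    rw [hS, ← sum_neg_distrib]
    refine sum_congr rfl fun w' _ => ?_
    rw [← sum_neg_distrib]
    refine sum_congr rfl fun w _ => ?_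
    by_cases h : G.Adj (ι w') (ι w)
    · rw [if_pos h, if_pos h.symm, hε w' w h, Units.val_neg, Int.cast_neg, neg_smul, neg_neg]
      simp only [hK, pairCreationBond_symm]
    · rw [if_neg h, if_neg (fun h' => h h'.symm), neg_zero]
  have h2 : (2 : ℂ) • S = 0 := by
    rw [two_smul]
    nth_rewrite 2 [hneg]
    exact add_neg_cancel S
  have hS0 : S = 0 := (smul_eq_zero.1 h2).resolve_left two_ne_zero
  simpa [hS, hK] using hS0

/-- **The on-site repulsion against the restricted pair-creator sum**: `[Σ_x n_{x↑}n_{x↓}, P] = P`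
(each pair creator adds one doubly occupied site). [cite: Yang1989, eq. (6)] -/
theorem interaction_commutator_restrictedEtaRaise (ι : W ↪ V) (c : W → ℂ) :
    (∑ x : V, numberOp x 0 * numberOp x 1) * (∑ w, c w • (creation (orb (ι w) 0) * creation (orb (ι w) 1))) -
      (∑ w, c w • (creation (orb (ι w) 0) * creation (orb (ι w) 1))) * (∑ x : V, numberOp x 0 * numberOp x 1) =
      ∑ w, c w • (creation (orb (ι w) 0) * creation (orb (ι w) 1)) := by
  rw [mul_sum_smul_sub_sum_smul_mul]
  refine sum_congr rfl fun w _ => ?_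
  congr 1
  rw [sum_mul, mul_sum, ← sum_sub_distrib]
  simp only [pairNumber_commutator_pairCreation, sum_ite_eq', mem_univ, if_true]

/-- **`[N, P] = 2P`** for the restricted pair-creator sum. [cite: EsslerEtAl2005, §2.2.5 eq. (2.87)] -/
theorem totalNumber_commutator_restrictedEtaRaise (ι : W ↪ V) (c : W → ℂ) :
    (totalNumber : Matrix (Finset (Orb V)) (Finset (Orb V)) ℂ) *
        (∑ w, c w • (creation (orb (ι w) 0) * creation (orb (ι w) 1))) -
      (∑ w, c w • (creation (orb (ι w) 0) * creation (orb (ι w) 1))) * totalNumber =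
      (2 : ℂ) • ∑ w, c w • (creation (orb (ι w) 0) * creation (orb (ι w) 1)) := by
  rw [mul_sum_smul_sub_sum_smul_mul, smul_sum]
  refine sum_congr rfl fun w _ => ?_
  rw [totalNumber_commutator_pairCreation, smul_comm]

/-- **Yang's commutator for the restricted sum, with boundary**: for the Hubbard Hamiltonian `H(t,U)` on a
finite graph, an injection `ι : W ↪ V` and a sign bipartite on the inner bonds,
`H P − P H = U P − t Σ_{x ∉ ι(W)} Σ_{w : x ∼ ι w} ε_{ι w} K(x, ι w)`: the bulk part of Yang's
`[H, η†] = U η†` plus a boundary pair-creation term. [cite: Yang1989, eq. (6)] -/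
theorem hamiltonian_commutator_restrictedEtaRaise (G : SimpleGraph V) [DecidableRel G.Adj] (ι : W ↪ V)
    (ε : V → ℤˣ) (hε : ∀ w w' : W, G.Adj (ι w) (ι w') → ε (ι w) = -ε (ι w')) (t U : ℝ) :
    hamiltonian G t U * (∑ w, ((ε (ι w) : ℤ) : ℂ) • (creation (orb (ι w) 0) * creation (orb (ι w) 1))) -
      (∑ w, ((ε (ι w) : ℤ) : ℂ) • (creation (orb (ι w) 0) * creation (orb (ι w) 1))) * hamiltonian G t U =
      (U : ℂ) • (∑ w, ((ε (ι w) : ℤ) : ℂ) • (creation (orb (ι w) 0) * creation (orb (ι w) 1))) -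
        (t : ℂ) • ∑ x ∈ (univ.map ι)ᶜ, ∑ w, if G.Adj x (ι w) then
          ((ε (ι w) : ℤ) : ℂ) • (creation (orb x 0) * creation (orb (ι w) 1) - creation (orb x 1) * creation (orb (ι w) 0))
          else 0 := by
  have hT := hopping_commutator_restrictedEtaRaise G ι ε hε
  have hV := interaction_commutator_restrictedEtaRaise (V := V) ι (fun w => ((ε (ι w) : ℤ) : ℂ))
  set T := ∑ x : V, ∑ y : V, ∑ σ : Fin 2,
    (if G.Adj x y then creation (orb x σ) * annihilation (orb y σ) else 0) with hTdef
  set Vop := ∑ x : V, numberOp x 0 * numberOp x 1 with hVdef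
  set P := ∑ w, ((ε (ι w) : ℤ) : ℂ) • (creation (orb (ι w) 0) * creation (orb (ι w) 1)) with hPdef
  set D := ∑ x ∈ (univ.map ι)ᶜ, ∑ w, (if G.Adj x (ι w) then
    ((ε (ι w) : ℤ) : ℂ) • (creation (orb x 0) * creation (orb (ι w) 1) - creation (orb x 1) * creation (orb (ι w) 0))
    else 0) with hDdef
  have hH : hamiltonian G t U = -(t : ℂ) • T + (U : ℂ) • Vop := rfl
  have e : hamiltonian G t U * P - P * hamiltonian G t U =
      -(t : ℂ) • (T * P - P * T) + (U : ℂ) • (Vop * P - P * Vop) := by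
    rw [hH, add_mul, mul_add, smul_mul_assoc, smul_mul_assoc, mul_smul_comm, mul_smul_comm, smul_sub, smul_sub]
    abel
  rw [e, hT, hV, neg_smul]
  abel

/-- **Yang's commutator for the grand-canonical `H(1,U) − μN` and the restricted sum, with boundary**:
`(H − μN) P − P (H − μN) = (U − 2μ) P − D_∂`. [cite: Yang1989, eq. (6)] [cite: EsslerEtAl2005, §2.2.5 eq. (2.87)] -/
theorem hamiltonianMu_commutator_restrictedEtaRaise (G : SimpleGraph V) [DecidableRel G.Adj] (ι : W ↪ V)
    (ε : V → ℤˣ) (hε : ∀ w w' : W, G.Adj (ι w) (ι w') → ε (ι w) = -ε (ι w')) (U μ : ℝ) :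
    (hamiltonian G 1 U - (μ : ℂ) • (totalNumber : Matrix (Finset (Orb V)) (Finset (Orb V)) ℂ)) *
        (∑ w, ((ε (ι w) : ℤ) : ℂ) • (creation (orb (ι w) 0) * creation (orb (ι w) 1))) -
      (∑ w, ((ε (ι w) : ℤ) : ℂ) • (creation (orb (ι w) 0) * creation (orb (ι w) 1))) *
        (hamiltonian G 1 U - (μ : ℂ) • (totalNumber : Matrix (Finset (Orb V)) (Finset (Orb V)) ℂ)) =
      ((U - 2 * μ : ℝ) : ℂ) • (∑ w, ((ε (ι w) : ℤ) : ℂ) • (creation (orb (ι w) 0) * creation (orb (ι w) 1))) -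
        ∑ x ∈ (univ.map ι)ᶜ, ∑ w, if G.Adj x (ι w) then
          ((ε (ι w) : ℤ) : ℂ) • (creation (orb x 0) * creation (orb (ι w) 1) - creation (orb x 1) * creation (orb (ι w) 0))
          else 0 := by
  have hH := hamiltonian_commutator_restrictedEtaRaise G ι ε hε 1 U
  have hN := totalNumber_commutator_restrictedEtaRaise (V := V) ι (fun w => ((ε (ι w) : ℤ) : ℂ))
  set P := ∑ w, ((ε (ι w) : ℤ) : ℂ) • (creation (orb (ι w) 0) * creation (orb (ι w) 1)) with hP
  set D := ∑ x ∈ (univ.map ι)ᶜ, ∑ w, (if G.Adj x (ι w) then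
    ((ε (ι w) : ℤ) : ℂ) • (creation (orb x 0) * creation (orb (ι w) 1) - creation (orb x 1) * creation (orb (ι w) 0))
    else 0) with hD
  have e : (hamiltonian G 1 U - (μ : ℂ) • (totalNumber : Matrix (Finset (Orb V)) (Finset (Orb V)) ℂ)) * P -
      P * (hamiltonian G 1 U - (μ : ℂ) • (totalNumber : Matrix (Finset (Orb V)) (Finset (Orb V)) ℂ)) =
      (hamiltonian G 1 U * P - P * hamiltonian G 1 U) -
        (μ : ℂ) • ((totalNumber : Matrix (Finset (Orb V)) (Finset (Orb V)) ℂ) * P - P * totalNumber) := by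
    rw [sub_mul, mul_sub, smul_mul_assoc, mul_smul_comm, smul_sub]
    abel
  rw [e, hH, hN, smul_smul, Complex.ofReal_one, one_smul, Complex.ofReal_sub, Complex.ofReal_mul,
    Complex.ofReal_ofNat, sub_smul, mul_comm (μ : ℂ) 2]
  abel

end Algebra

end Literature.MathematicalPhysics.QuantumLattice

end
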